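import Mathlib.Algebra.Group.Prod
import Mathlib.Data.Finset.Prod
import Mathlib.Tactic
import Literature.Combinatorics.Additive.TripleProductProperty
import Literature.Computability.AlgebraicComplexity.CohnUmansTPP
import HarnessLib

/-!
# TPP triples multiply under direct products

If `(S₁,T₁,U₁)` satisfies the TPP in `A` and `(S₂,T₂,U₂)` in `B` (right-quotient form of `RealizesTPP`), then
`(S₁ ×ˢ S₂, T₁ ×ˢ T₂, U₁ ×ˢ U₂)` satisfies it in `A × B`; hence `β(A × B) ≥ β(A)·β(B)` and
`RealizesTPP A a b c → RealizesTPP B a' b' c' → RealizesTPP (A × B) (a a') (b b') (c c')`.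
Certificate format for the lane's direct-product census bounds (speedrun tpp, seat sr-tpp-search-g10, `py/prod10b.py`).
-/

namespace Summit.MatrixMultiplication.OmegaCensus.DirectProductTPP

open Literature.Computability.AlgebraicComplexity

variable {A B : Type*} [Group A] [Group B]

/-- TPP is preserved by direct products of triples. -/
theorem tpp_prod {S₁ T₁ U₁ : Finset A} {S₂ T₂ U₂ : Finset B}
    (h₁ : ∀ s ∈ S₁, ∀ s' ∈ S₁, ∀ t ∈ T₁, ∀ t' ∈ T₁, ∀ u ∈ U₁, ∀ u' ∈ U₁,
      s * s'⁻¹ * (t * t'⁻¹) * (u * u'⁻¹) = 1 → s = s' ∧ t = t' ∧ u = u')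
    (h₂ : ∀ s ∈ S₂, ∀ s' ∈ S₂, ∀ t ∈ T₂, ∀ t' ∈ T₂, ∀ u ∈ U₂, ∀ u' ∈ U₂,
      s * s'⁻¹ * (t * t'⁻¹) * (u * u'⁻¹) = 1 → s = s' ∧ t = t' ∧ u = u') :
    ∀ s ∈ S₁ ×ˢ S₂, ∀ s' ∈ S₁ ×ˢ S₂, ∀ t ∈ T₁ ×ˢ T₂, ∀ t' ∈ T₁ ×ˢ T₂, ∀ u ∈ U₁ ×ˢ U₂, ∀ u' ∈ U₁ ×ˢ U₂,
      s * s'⁻¹ * (t * t'⁻¹) * (u * u'⁻¹) = 1 → s = s' ∧ t = t' ∧ u = u' := by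
  rintro ⟨s₁, s₂⟩ hs ⟨s₁', s₂'⟩ hs' ⟨t₁, t₂⟩ ht ⟨t₁', t₂'⟩ ht' ⟨u₁, u₂⟩ hu ⟨u₁', u₂'⟩ hu' heq
  simp only [Finset.mem_product] at hs hs' ht ht' hu hu'
  simp only [Prod.inv_mk, Prod.mk_mul_mk, Prod.mk_eq_one] at heq
  obtain ⟨rfl, rfl, rfl⟩ := h₁ s₁ hs.1 s₁' hs'.1 t₁ ht.1 t₁' ht'.1 u₁ hu.1 u₁' hu'.1 heq.1
  obtain ⟨rfl, rfl, rfl⟩ := h₂ s₂ hs.2 s₂' hs'.2 t₂ ht.2 t₂' ht'.2 u₂ hu.2 u₂' hu'.2 heq.2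
  exact ⟨rfl, rfl, rfl⟩

/-- **Capacities are super-multiplicative**: `β(A × B) ≥ β(A)·β(B)`, in `RealizesTPP` form. -/
theorem realizesTPP_prod {a b c a' b' c' : ℕ} (hA : RealizesTPP A a b c) (hB : RealizesTPP B a' b' c') :
    RealizesTPP (A × B) (a * a') (b * b') (c * c') := by
  obtain ⟨S₁, T₁, U₁, hS₁, hT₁, hU₁, h₁⟩ := hA
  obtain ⟨S₂, T₂, U₂, hS₂, hT₂, hU₂, h₂⟩ := hB
  refine ⟨S₁ ×ˢ S₂, T₁ ×ˢ T₂, U₁ ×ˢ U₂, ?_, ?_, ?_, tpp_prod h₁ h₂⟩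
  · rw [Finset.card_product, hS₁, hS₂]
  · rw [Finset.card_product, hT₁, hT₂]
  · rw [Finset.card_product, hU₁, hU₂]

end Summit.MatrixMultiplication.OmegaCensus.DirectProductTPP
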